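import Literature.AlgebraicGeometry.Morphisms.ProjectiveOfPushforwardFrame
import Literature.AlgebraicGeometry.Morphisms.ProjectiveOverBaseOfFibresEmbedding
import Literature.AlgebraicGeometry.Motives.GeneratingSectionsClosedImmersionBaseChange
import HarnessLib

/-!
# A frame of `f_* E` plus embeddings of the fibres over field EXTENSIONS make `f` projective (EGA III 4.7.1, descent form)

Topic `AlgebraicGeometry/Morphisms`; namespace `Literature.AlgebraicGeometry.Morphisms`.  THEOREMS ONLY (no definition, no named fact,
no instance, no notation, no `sorry`).  Cell `hodgecm-mathlib` (D-0151), F-DAG F-6 functor side, hand (FS-a′) (B-plan1 (g16) 08:27:31Z;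
author B-p06 (g12); the sequel of ★ `Morphisms/ProjectiveOfPushforwardFrame` = (FS-a), B-p20 (g11)).  Count-neutral Mathlib-side capital:
HC_CM is proved only modulo the 7 printed citations until rung 0 closes — nothing here is about HC.

★ `isProjective_of_pushforwardFrame` (EGA III 4.7.1 / [MumfordAV1970] §5 Cor. 3, functor side) asks, for every `t ∈ T`, for a fibre
presentation over a ring `K` TO WHICH `κ(t)` RETRACTS (`σ : Spec κ(t) → Spec K`, `σ ≫ iK = Spec κ(t) → T`; e.g. `K = κ(t)`) whose fibre
is embedded by finitely many sections.  On the F-6 functor side the embedding is known only on GEOMETRIC fibres (Lefschetz over an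
algebraically closed field).  This file supplies the descent: it is enough that every `t ∈ T` has a field EXTENSION `j : κ(t) → K`
and a presentation `X₀ = X ×_T Spec K` of the `K`-fibre embedded by finitely many sections of `E|_{X₀}`.  Indeed (§1) the frame
sections `b₀, …, b_m` of `f_* E` then generate `E` at every point (every point lies on such a fibre; ★
`isClosedImmersion_toProj_comap_of_pushforwardFrame`: on the presented fibre the `b_j` generate and their restrictions embed, their
span being all sections by cohomology and base change), and (§2) over `κ(t)` the restriction of the datum of the `b_j` to the
scheme-theoretic fibre `f⁻¹(t)` is a CLOSED IMMERSION into `ℙ^m_{κ(t)}`, because its base change to `K` is (the presented fibre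
maps to `f⁻¹(t)` by a cartesian square over `Spec K → Spec κ(t)`, ★ `GeneratingSections.comap_comp` / `ofCocycleSections_comap`)
and closed immersions DESCEND along the fpqc cover `Spec K → Spec κ(t)` (★ `GeneratingSections.isClosedImmersion_toProj_of_comap`,
over ★ `Morphisms.isClosedImmersion_descendsAlong`, [StacksProject, Tag 02L6]).  Then ★ `isProjective_of_pushforwardFrame` /
★ `isClosedImmersion_pointOfSections_of_pushforwardFrame` conclude.

* §1 `exists_mem_basicOpen_coeffAt_of_fieldExtension` — the frame sections generate `E` (pointwise form; `= ⊤` by ★ `iSup_basicOpen_coeffAt_eq_top_iff`);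
* §2 **`fibres_embedding_of_fieldExtension`** — THE TRANSLATION: every `t` acquires the per-point binder of ★ `isProjective_of_pushforwardFrame`
  (at `K := κ(t)`, `σ := 𝟙`, the scheme-theoretic fibre embedded by the restricted frame sections), so that
  `isProjective_of_pushforwardFrame f F h1 e hvan (fibres_embedding_of_fieldExtension f F h1 e hvan H) : IsProjective f`;
* §3 **`exists_isClosedImmersion_pointOfSections_of_fieldExtension`** — `X ↪ 𝐏(ι; T)` is a closed immersion over `T`.

Consumer: the instantiation (FS-b) `AbelianSchemes/PolarizedLevelFrameEmbedding` (polarised abelian scheme, `E = L^Δ(λ)^{⊗3}`,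
`K = κ(t)̄`).

## References
* [EGAIII1] A. Grothendieck, J. Dieudonné, *EGA III₁* (1961), Thm. 4.7.1, Prop. 4.6.7 (ii).
* [StacksProject] The Stacks Project, Tag 02L6 (closed immersions descend along fpqc covers).
* [MumfordAV1970] D. Mumford, *Abelian Varieties* (1970), §5 Cor. 3 (p. 53).
* [Hartshorne1977] R. Hartshorne, *Algebraic Geometry* (1977), II Thm. 7.1; II §4 Definition p.103 (projective morphism).
-/

noncomputable section

-- `TopCat.Presheaf`/`Scheme.Modules` and pull-back bookkeeping (as in ★ `Morphisms/ProjectiveOfPushforwardFrame`).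
set_option backward.isDefEq.respectTransparency false

open CategoryTheory CategoryTheory.Limits CategoryTheory.Abelian AlgebraicGeometry TopologicalSpace Opposite
open Literature.AlgebraicGeometry.Modules
open Literature.AlgebraicGeometry.Motives Literature.AlgebraicGeometry.Motives.GeneratingSections

namespace Literature.AlgebraicGeometry.Morphisms

section FieldExtension

variable {X T : Scheme.{0}} [IsLocallyNoetherian T] (f : X ⟶ T) [IsProper f] [Flat f] {E : X.Modules}
  (F : FrameSystem E) (h1 : ∀ x, F.rank x = 1) {m : ℕ}
  (e : SheafOfModules.free (Fin (m + 1)) ≅ ((Scheme.Modules.pushforward f).obj E).over ⊤)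
  (hvan : ∀ ⦃K : Type⦄ [Field K] ⦃X₀ : Scheme.{0}⦄ (i : X₀ ⟶ X) (f₀ : X₀ ⟶ Spec (CommRingCat.of K))
    (x : Spec (CommRingCat.of K) ⟶ T), IsPullback i f₀ f x →
      Subsingleton (Ext.{1} (unitModule X₀) ((Scheme.Modules.pullback i).obj E) 1))
  (H : ∀ t : T, ∃ (K : Type) (_ : Field K) (j : T.residueField t →+* K) (X₀ : Scheme.{0}) (iX : X₀ ⟶ X)
    (f₀ : X₀ ⟶ Spec (.of K)) (_ : IsPullback iX f₀ f (Spec.map (CommRingCat.ofHom j) ≫ T.fromSpecResidueField t))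
    (h1₀ : ∀ x, (F.pullback iX).rank x = 1) (n : ℕ) (s : Fin (n + 1) → Γ((Scheme.Modules.pullback iX).obj E, ⊤))
    (hcov : ⨆ i, ⨆ x, X₀.basicOpen ((CocycleSections.ofFrameSystem (F.pullback iX) h1₀ s).coeff i x) = ⊤),
    IsClosedImmersion ((ofCocycleSections (F.pullback iX).U
      (CocycleSections.ofFrameSystem (F.pullback iX) h1₀ s) hcov).toProj f₀))

/-! ## §1 The frame sections generate `E` -/

include hvan H in
/-- **Every point of `X` lies in some `X_{b_j}`**: `x` lies on the presented fibre over `f x` (the unique point of `Spec K` maps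
to `f x`), on which the frame sections generate by ★ `isClosedImmersion_toProj_comap_of_pushforwardFrame`; hence (★
`iSup_basicOpen_coeffAt_eq_top_iff`) the frame sections `b₀, …, b_m` generate `E`.
[cite: EGAIII1, Thm. 4.7.1] [cite: MumfordAV1970, §5 Cor. 3 (p. 53)] -/
theorem exists_mem_basicOpen_coeffAt_of_fieldExtension (x : X) :
    ∃ j, x ∈ X.basicOpen (GeneratingSections.coeffAt F h1 (fun j ↦ (basisSection e j :)) j x) := by
  obtain ⟨K, _, j, X₀, iX, f₀, HX, h1₀, n, s, hcov, Hemb⟩ := H (f x)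
  obtain ⟨hgen, -⟩ := isClosedImmersion_toProj_comap_of_pushforwardFrame f F h1 e hvan HX h1₀ s hcov Hemb
  -- a point of `X₀` over `x`
  let pt : Spec (.of K) := IsLocalRing.closedPoint K
  have hpt : f x = (Spec.map (CommRingCat.ofHom j) ≫ T.fromSpecResidueField (f x)) pt := by
    rw [Scheme.Hom.comp_apply]
    exact (Scheme.fromSpecResidueField_apply (f x) _).symm
  obtain ⟨z, hz, -⟩ := Scheme.Pullback.exists_preimage_pullback x pt hpt
  obtain ⟨i, hi⟩ := hgen (HX.isoPullback.inv z)
  refine ⟨i, ?_⟩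
  rwa [← Scheme.Hom.comp_apply, IsPullback.isoPullback_inv_fst, hz] at hi

/-! ## §2 The translation: every scheme-theoretic fibre is embedded by the frame sections (descent along `Spec K → Spec κ(t)`) -/

include h1 e hvan H in
/-- **THE TRANSLATION TO ★ `isProjective_of_pushforwardFrame`'s per-point binder**: for every `t ∈ T`, the scheme-theoretic fibre
`f⁻¹(t) → Spec κ(t)` (Mathlib `Scheme.Hom.fiber`; `K := κ(t)`, `σ := 𝟙`) is embedded into `ℙ^m_{κ(t)}` by the restricted frame
sections `η(b₀), …, η(b_m)`, which generate `E|_{f⁻¹(t)}`.  Proof: the presented `K`-fibre `X₀` of `H` maps to `f⁻¹(t)` by a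
cartesian square `k` over `Spec K → Spec κ(t)` (pasting); on `X₀` the frame sections generate and embed (★
`isClosedImmersion_toProj_comap_of_pushforwardFrame`, its span clause paid by cohomology and base change); their datum on `X₀` is
the datum on `f⁻¹(t)` pulled back along `k` (★ `comap_comp_eq_comap_ofFrameSystem_pullback`, ★ `ofCocycleSections_comap`), and
closed immersions of `toProj` DESCEND along the surjective flat `Spec K → Spec κ(t)` (★
`GeneratingSections.isClosedImmersion_toProj_of_comap`, [StacksProject, Tag 02L6]).  Feed it to ★ `isProjective_of_pushforwardFrame f F h1 e hvan`
(`f` is PROJECTIVE) and to ★ `isClosedImmersion_pointOfSections_of_pushforwardFrame` (§3).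
[cite: StacksProject, Tag 02L6] [cite: EGAIII1, Thm. 4.7.1 and Prop. 4.6.7 (ii)] [cite: MumfordAV1970, §5 Cor. 3 (p. 53)] -/
theorem fibres_embedding_of_fieldExtension (t : T) :
    ∃ (K : Type) (_ : CommRing K) (iK : Spec (.of K) ⟶ T) (σ : Spec (T.residueField t) ⟶ Spec (.of K))
    (_ : σ ≫ iK = T.fromSpecResidueField t) (X₀ : Scheme.{0}) (iX : X₀ ⟶ X) (f₀ : X₀ ⟶ Spec (.of K))
    (_ : IsPullback iX f₀ f iK) (h1₀ : ∀ x, (F.pullback iX).rank x = 1) (n : ℕ)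
    (s : Fin (n + 1) → Γ((Scheme.Modules.pullback iX).obj E, ⊤))
    (hcov : ⨆ i, ⨆ x, X₀.basicOpen ((CocycleSections.ofFrameSystem (F.pullback iX) h1₀ s).coeff i x) = ⊤),
    IsClosedImmersion ((ofCocycleSections (F.pullback iX).U
      (CocycleSections.ofFrameSystem (F.pullback iX) h1₀ s) hcov).toProj f₀) := by
  -- the frame sections generate `E`, hence their restrictions generate `E|_{f⁻¹(t)}`
  have hcovb : ⨆ j, ⨆ x, X.basicOpen (GeneratingSections.coeffAt F h1 (fun j ↦ (basisSection e j :)) j x) = ⊤ :=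
    (iSup_basicOpen_coeffAt_eq_top_iff F h1 _).mpr (exists_mem_basicOpen_coeffAt_of_fieldExtension f F h1 e hvan H)
  have Hf : IsPullback (f.fiberι t) (f.fiberToSpecResidueField t) f (T.fromSpecResidueField t) :=
    IsPullback.of_hasPullback _ _
  have h1t : ∀ x, (F.pullback (f.fiberι t)).rank x = 1 := fun x ↦ h1 ((f.fiberι t).base x)
  have hcovt := iSup_basicOpen_coeffAt_pullback_eq_top F h1 (fun j ↦ (basisSection e j :)) (f.fiberι t) h1t hcovb
  refine ⟨T.residueField t, inferInstance, T.fromSpecResidueField t, 𝟙 _, Category.id_comp _, f.fiber t, f.fiberι t,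
    f.fiberToSpecResidueField t, Hf, h1t, m, fun j ↦ unitSectionLE (f.fiberι t) E (V := ⊤) (U := ⊤) le_top (basisSection e j :),
    hcovt, ?_⟩
  -- the presented `K`-fibre over `f⁻¹(t)`
  obtain ⟨K, _, j, X₀, iX, f₀, HX, h1₀, n, s, hcov, Hemb⟩ := H t
  obtain ⟨k, hk₁, hk₂⟩ : ∃ k : X₀ ⟶ f.fiber t, k ≫ f.fiberι t = iX ∧
      k ≫ f.fiberToSpecResidueField t = f₀ ≫ Spec.map (CommRingCat.ofHom j) :=
    ⟨Hf.lift iX (f₀ ≫ Spec.map (CommRingCat.ofHom j)) (by rw [Category.assoc]; exact HX.w), Hf.lift_fst _ _ _,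
      Hf.lift_snd _ _ _⟩
  subst hk₁
  letI : Algebra (IsLocalRing.ResidueField (T.presheaf.stalk t)) K := j.toAlgebra
  have Hk : IsPullback k f₀ (f.fiberToSpecResidueField t)
      (Spec.map (CommRingCat.ofHom (algebraMap (IsLocalRing.ResidueField (T.presheaf.stalk t)) K))) :=
    IsPullback.of_right HX hk₂ Hf
  -- on `X₀` the restricted frame sections embed; their datum is the pull-back along `k` of the datum on `f⁻¹(t)`
  obtain ⟨-, hcov₀, Hemb₀⟩ := isClosedImmersion_toProj_comap_of_pushforwardFrame f F h1 e hvan HX h1₀ s hcov Hemb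
  have eD : ofCocycleSections (fun a ↦ (k ≫ f.fiberι t) ⁻¹ᵁ F.U a)
      ((CocycleSections.ofFrameSystem F h1 fun j ↦ (basisSection e j :)).comap (k ≫ f.fiberι t)) hcov₀ =
      (ofCocycleSections (F.pullback (f.fiberι t)).U (CocycleSections.ofFrameSystem (F.pullback (f.fiberι t)) h1t
        fun j ↦ unitSectionLE (f.fiberι t) E (V := ⊤) (U := ⊤) le_top (basisSection e j :)) hcovt).comap k := by
    rw [← comap_comp_eq_comap_ofFrameSystem_pullback (f.fiberι t) k F h1 (fun j ↦ (basisSection e j :)) hcovb h1t hcovt]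
    exact ofCocycleSections_comap (k ≫ f.fiberι t) _ _
  rw [eD] at Hemb₀
  -- descent along `Spec K → Spec κ(t)`
  obtain ⟨hsurj, hflat⟩ := surjective_and_flat_SpecMap_of_field (κ := IsLocalRing.ResidueField (T.presheaf.stalk t))
    (K := .of K) (CommRingCat.ofHom (algebraMap (IsLocalRing.ResidueField (T.presheaf.stalk t)) K))
  haveI := hsurj
  haveI := hflat
  haveI := Hemb₀
  exact GeneratingSections.isClosedImmersion_toProj_of_comap _ (f.fiberToSpecResidueField t) f₀ k Hk

end FieldExtension

/-! ## §3 The closed immersion `X ↪ 𝐏(ι; T)` over `T` -/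

section PointOfSections

variable {X T : Scheme.{0}} [IsLocallyNoetherian T] (f : X ⟶ T) [IsProper f] [Flat f] {E : X.Modules}
  (F : FrameSystem E) (h1 : ∀ x, F.rank x = 1) (ι : Type)
  (e : SheafOfModules.free (Fin (Nat.card ι + 1)) ≅ ((Scheme.Modules.pushforward f).obj E).over ⊤)
  (hvan : ∀ ⦃K : Type⦄ [Field K] ⦃X₀ : Scheme.{0}⦄ (i : X₀ ⟶ X) (f₀ : X₀ ⟶ Spec (CommRingCat.of K))
    (x : Spec (CommRingCat.of K) ⟶ T), IsPullback i f₀ f x →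
      Subsingleton (Ext.{1} (unitModule X₀) ((Scheme.Modules.pullback i).obj E) 1))
  (H : ∀ t : T, ∃ (K : Type) (_ : Field K) (j : T.residueField t →+* K) (X₀ : Scheme.{0}) (iX : X₀ ⟶ X)
    (f₀ : X₀ ⟶ Spec (.of K)) (_ : IsPullback iX f₀ f (Spec.map (CommRingCat.ofHom j) ≫ T.fromSpecResidueField t))
    (h1₀ : ∀ x, (F.pullback iX).rank x = 1) (n : ℕ) (s : Fin (n + 1) → Γ((Scheme.Modules.pullback iX).obj E, ⊤))
    (hcov : ⨆ i, ⨆ x, X₀.basicOpen ((CocycleSections.ofFrameSystem (F.pullback iX) h1₀ s).coeff i x) = ⊤),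
    IsClosedImmersion ((ofCocycleSections (F.pullback iX).U
      (CocycleSections.ofFrameSystem (F.pullback iX) h1₀ s) hcov).toProj f₀))

include hvan H in
/-- **EGA III 4.7.1, descent form — the frame sections generate `E` and embed `X ↪ 𝐏(ι; T)` as a CLOSED IMMERSION over `T`**
(`T` locally Noetherian, `f` proper flat, rank-one frames, fibrewise `H¹ = 0`, a frame `e` of `f_* E` indexed by the `#ι + 1`
homogeneous coordinates, and at every point a field EXTENSION over which the fibre is embedded by finitely many sections):
★ `isClosedImmersion_pointOfSections_of_pushforwardFrame` fed with the translation §2.  (`f` is PROJECTIVE by ★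
`isProjective_of_pushforwardFrame f F h1 e hvan (fibres_embedding_of_fieldExtension f F h1 e hvan H)`.)
[cite: EGAIII1, Thm. 4.7.1 and Prop. 4.6.7 (ii)] [cite: Hartshorne1977, II §4 Definition p.103 (projective morphism)] -/
theorem exists_isClosedImmersion_pointOfSections_of_fieldExtension :
    ∃ hcov, IsClosedImmersion (projectiveSpace.pointOfSections (Over.mk f)
      (ofCocycleSections F.U (CocycleSections.ofFrameSystem F h1 fun j ↦ (basisSection e j :)) hcov)).left :=
  ⟨_, isClosedImmersion_pointOfSections_of_pushforwardFrame f F h1 ι e hvan (fibres_embedding_of_fieldExtension f F h1 e hvan H)⟩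

end PointOfSections

end Literature.AlgebraicGeometry.Morphisms

end
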